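import Summits.QuantumFields.YangMills.Theorems.BalabanUVNodesN15KingModelToronResolvent
import Mathlib.RingTheory.RootsOfUnity.Complex
import HarnessLib

/-!
# BalabanUVNodes ∕ N15 — THE KING-MODEL RUNG (PART Ͷ-c): TORONS MODULO GAUGE — character gauges shift the phases by the dual lattice; the HOLONOMY `ω_μ^{K_μ}` (a Polyakov loop)
# is invariant under EVERY `U(1)` gauge; two torons are gauge equivalent IFF their holonomies agree (the toron moduli = `U(1)^{d+1}`); every toron is gauge equivalent to a REDUCED
# one `e^{iθ∕K}`, `|θ_μ| ≤ π`; the spectrum depends on the phases only through the holonomy; the SEAM (twisted-boundary-condition) gauge of a toron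
# (Track A, DAG node N15 = NE2; FAN-OUT v1.1 §N15 s3 «KING-MODEL RUNG … + what the curved case adds»; count-neutral)

HONEST FRAMING.  Count-neutral (cell `pub-ymgap`, seat `pub-ymgap-dag-n15-e` g44; `--supports stmt-QuantumFields-27247 --as helper` = K3ᴬ, KEY MAP v3).  One finite torus
`T = Π_μℤ∕K_μ`; constant abelian `U(1)` link fields in King's `A = 0` comparison model; folklore lattice gauge kinematics ([tHooft1979Flux] = 't Hooft, NPB 153 (1979), twisted boundary conditions; the tree's
`FlatLatticeGaugeFields.flat_iff_exists_gaugeTransform_seamConfig` classifies ALL flat fields on the cubic torus as gauge transforms of seam configurations — cited, other carrier; here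
the abelian constant-field sector on King's anisotropic torus, with the spectral consequences).  NOT Bałaban's `G_k(U)`; NOT a node discharge; nothing continuum ∕ ℝ⁴ ∕ OS ∕ Clay.

THE RESULTS (PART Ͱ-a's gauge action `kingGaugeAct g U (x,μ) = g(x)U(x,μ)g(x+e_μ)^*`, PART Ͷ-a's `toronLink ω`):
* §1 CHARACTER GAUGES `charGauge p x = e^{ip·x}`: ★★ **`kingGaugeAct_charGauge_toronLink`** (`(e^{ip·})·ω·(e^{ip·})^* = (ω_μe^{−ip·e_μ})_μ` — a toron goes to a toron, the phase shifted
  by the DUAL LATTICE vector `p′(p) ∈ (2π∕K)ℤ^{d+1}`: `kingGaugeAct_charGauge_toronLink_twistOf`, `e^{iφ} ↦ e^{i(φ − p′(p))}`);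
* §2 THE HOLONOMY `toronHol K ω μ := ω_μ^{K_μ}` and the POLYAKOV LOOP `polyakov K U x μ := Π_{t<K_μ} U(x + te_μ, μ)` of a `U(1)` link field: `polyakov_toronLink` (`= ω_μ^{K_μ}` at every
  base point), ★★★ **`polyakov_kingGaugeAct`** (`Π_t U^g = Π_t U` for EVERY unitary gauge `g` — telescoping around the closed cycle `x + K_μe_μ = x`), hence ★★ `toronHol_eq_of_gaugeEquiv`
  (gauge-equivalent torons have the same holonomies: the holonomy is NOT a gauge artefact);
* §3 THE CONVERSE: ★★ `exists_charGauge_of_toronHol_eq` (equal holonomies ⇒ `ω'_μ∕ω_μ` is a `K_μ`-th root of unity `= e^{−ip′_μ(p)}` for a dual momentum `p` (Mathlib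
  `IsPrimitiveRoot.eq_pow_of_pow_eq_one`) ⇒ the character gauge `e^{ip·}` does it); ★★★ **`toronLink_gaugeEquiv_iff`** — TWO TORONS ARE GAUGE EQUIVALENT IFF THEIR HOLONOMIES AGREE:
  the gauge classes of torons are the points of `U(1)^{d+1}` (the abelian toron moduli of the discrete torus); ★★ **`exists_reduced_gaugeEquiv`** — every toron is gauge equivalent to
  `e^{iθ∕K}` with REDUCED angles `θ_μ = arg(ω_μ^{K_μ}) ∈ (−π, π]` (the hypothesis `|θ_μ| ≤ π` of PART Ͷ-d is no loss);
* §4 SPECTRAL INVARIANCE: `lapSymTw_sub_sOf` (`lapSymTw(φ − p′(p), q + p) = lapSymTw(φ, q)` — a dual-lattice shift of the phases RELABELS the momentum grid), ★★ `sum_lapSymTw_sub_sOf`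
  (`Σ_qF(lapSymTw(φ − p′(p), q)) = Σ_qF(lapSymTw(φ, q))` for every `F`: the spectrum as a multiset, hence `det`, `tr`, the diagonal `toronDiag`, the gap, depend on `φ` only through
  the holonomy `e^{iK_μφ_μ}`);
* §5 THE SEAM GAUGE (twisted boundary conditions): with `seamGauge ω x = Π_νω_ν^{val x_ν}`, ★★ **`kingGaugeAct_seamGauge_toronLink`** — `U^g(x,μ) = 1` off the seam `val x_μ + 1 < K_μ` and
  `= ω_μ^{K_μ}` (the holonomy) ON the seam `val x_μ = K_μ − 1`: the constant-link presentation and 't Hooft's twisted-boundary-condition presentation are the same toron.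

PRIOR TREE ART (by name): Ͱ-a (`kingGaugeAct`, `covLapF_kingGaugeAct`), Ε-e `norm_chi_eq_one` (through Ͷ-b), Ͷ-a (`toronLink`, `toronLink_apply`, `lapSymTw`, `stdAddChar_eq_exp_sOf`, `norm_twistOf_eq_one`), `B5Prop11Plancherel`
(`chi`, `chi_add_right`, `chi_unitVec`, `chi_zero_left`∕`_right`, `sOf`, `unitVec`), `King1986.Torus.chi_unitVec_eq_exp`, `B5ToronMomentum161.twistOf`, Mathlib (`Complex.isPrimitiveRoot_exp`,
`IsPrimitiveRoot.eq_pow_of_pow_eq_one`, `ZMod.stdAddChar_coe`, `Complex.norm_mul_exp_arg_mul_I`, `Complex.abs_arg_le_pi`, `ZMod.val_add`, `AddChar.norm_apply`).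
Dedup (rg at filing): basename 0 files; needles `charGauge|toronHol|polyakov_kingGaugeAct|toronLink_gaugeEquiv_iff|seamGauge` 0 tree files (the tree's `FlatLatticeGaugeFields.seamConfig`
lives on `GaugeConfig d L G`, a different carrier; not restated).  Locators: [Balaban1985BackgroundPropagators] p.398 l.19 (gauge covariance), (3.3) p.391; [King1986] (4.4) p.670;
[tHooft1979Flux] 't Hooft, NPB 153 (1979) (not held; cited for the notion only, no page locator).  0 `sorry`, 4 `def` (`charGauge`, `toronHol`, `polyakov`, `seamGauge`).
-/

noncomputable section

open scoped BigOperators ComplexConjugate ComplexOrder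
open Finset Matrix Complex

namespace Summit.QuantumFields.YangMills.BalabanUVNodes.N15KingModelRung.Toron

open Literature.MathematicalPhysics.QuantumFieldTheory.LatticeDiamagneticInequality (Hopping)
open Literature.MathematicalPhysics.QuantumFieldTheory.Balaban1983to89.B5Prop11Plancherel
open Literature.MathematicalPhysics.QuantumFieldTheory.Balaban1983to89.B5ToronMomentum161 (twistOf)
open Literature.MathematicalPhysics.QuantumFieldTheory.King1986.Torus (lapSym chi_unitVec_eq_exp chi_neg_left)
open Summit.QuantumFields.YangMills.BalabanUVNodes.N15KingModelRung.Covariant (covLapF kingGaugeAct kingGaugeMat mem_unitaryGroup_unit_iff)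
open Summit.QuantumFields.YangMills.BalabanUVNodes.N15KingModelRung.TorusSpectral (norm_chi_eq_one)

variable {d : ℕ} (K : Fin (d + 1) → ℕ)

/-! ## §1 Character gauges shift the toron by the dual lattice -/

section Characters

variable [hK : ∀ μ, NeZero (K μ)]

/-- THE CHARACTER GAUGE `g_p(x) = e^{ip·x}` (as a `U(1)`-valued `1 × 1` site field). [cite: Balaban1985BackgroundPropagators, p.398 l.19] -/
def charGauge (p : Tor K) : Tor K → Matrix Unit Unit ℂ := fun x => Matrix.of fun _ _ => chi K p x

/-- Entries. [folklore] -/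
@[simp] theorem charGauge_apply (p x : Tor K) (i j : Unit) : charGauge K p x i j = chi K p x := rfl

/-- `e^{ip·x}·conj e^{ip·x} = 1`. [folklore] -/
theorem chi_mul_conj (p x : Tor K) : chi K p x * conj (chi K p x) = 1 := by
  rw [Complex.mul_conj', norm_chi_eq_one]; norm_num

/-- The character gauge is unitary. [folklore] -/
theorem charGauge_mem_unitaryGroup (p x : Tor K) : charGauge K p x ∈ Matrix.unitaryGroup Unit ℂ :=
  (mem_unitaryGroup_unit_iff (charGauge K p x)).mpr (by rw [charGauge_apply]; exact norm_chi_eq_one K p x)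

/-- Products of `1 × 1` matrices. [folklore] -/
theorem unit_mul_apply (A B : Matrix Unit Unit ℂ) : (A * B) () () = A () () * B () () := by
  simp [Matrix.mul_apply]

/-- ★★ **A CHARACTER GAUGE SHIFTS THE TORON BY A DUAL-LATTICE PHASE**: `g_p·(ω_μ)·g_p^* = (ω_μ·e^{−ip·e_μ})_μ` — again a toron.
[cite: Balaban1985BackgroundPropagators, p.398 l.19; tHooft1979Flux, NPB 153] -/
theorem kingGaugeAct_charGauge_toronLink (p : Tor K) (ω : Fin (d + 1) → ℂ) :
    kingGaugeAct K (charGauge K p) (toronLink K ω) = toronLink K (fun μ => ω μ * conj (chi K p (unitVec K μ))) := by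
  funext ⟨x, μ⟩
  ext i j
  obtain rfl : i = () := rfl; obtain rfl : j = () := rfl
  simp only [kingGaugeAct, toronLink_apply]
  rw [unit_mul_apply, unit_mul_apply, Matrix.conjTranspose_apply, charGauge_apply, charGauge_apply, toronLink_apply, chi_add_right, Complex.star_def, map_mul]
  calc chi K p x * ω μ * (conj (chi K p x) * conj (chi K p (unitVec K μ)))
      = ω μ * conj (chi K p (unitVec K μ)) * (chi K p x * conj (chi K p x)) := by ring
    _ = ω μ * conj (chi K p (unitVec K μ)) := by rw [chi_mul_conj, mul_one]

/-- `conj e^{ip·e_μ} = e^{−ip′_μ(p)}`. [folklore] -/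
theorem conj_chi_unitVec_eq_exp (p : Tor K) (μ : Fin (d + 1)) : conj (chi K p (unitVec K μ)) = Complex.exp (-(((sOf K p μ : ℝ) : ℂ) * I)) := by
  rw [chi_unitVec_eq_exp, ← Complex.exp_conj, map_mul, Complex.conj_ofReal, Complex.conj_I, mul_neg]

/-- ★★ In phases: `g_p·e^{iφ}·g_p^* = e^{i(φ − p′(p))}` — the dual lattice `(2π∕K_μ)ℤ` acts on the phase vector. [cite: Balaban1984PropagatorsI, (1.29) p.23; tHooft1979Flux, NPB 153] -/
theorem kingGaugeAct_charGauge_toronLink_twistOf (p : Tor K) (φ : Fin (d + 1) → ℝ) :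
    kingGaugeAct K (charGauge K p) (toronLink K (twistOf φ)) = toronLink K (twistOf (φ - sOf K p)) := by
  rw [kingGaugeAct_charGauge_toronLink]
  congr 1
  funext μ
  rw [conj_chi_unitVec_eq_exp, twistOf, twistOf, ← Complex.exp_add]
  congr 1
  simp only [Pi.sub_apply]; push_cast; ring

end Characters

/-! ## §2 The holonomy and the Polyakov loop: gauge invariance -/

section Holonomy

/-- THE HOLONOMY of the toron around the `μ`-cycle: `ω_μ^{K_μ}`. [cite: tHooft1979Flux, NPB 153 (twisted boundary conditions)] -/
def toronHol (ω : Fin (d + 1) → ℂ) (μ : Fin (d + 1)) : ℂ := ω μ ^ K μ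

variable [hK : ∀ μ, NeZero (K μ)]

/-- THE POLYAKOV LOOP of a `U(1)` link field around the `μ`-cycle through `x`: `Π_{t<K_μ} U(x + te_μ, μ)`. [cite: tHooft1979Flux, NPB 153 (twisted boundary conditions)] -/
def polyakov (U : Tor K × Fin (d + 1) → Matrix Unit Unit ℂ) (x : Tor K) (μ : Fin (d + 1)) : ℂ :=
  ∏ t : Fin (K μ), U (x + (t : ℕ) • unitVec K μ, μ) () ()

omit hK in
/-- The Polyakov loop of a toron is its holonomy, at every base point. [cite: tHooft1979Flux, NPB 153 (twisted boundary conditions)] -/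
theorem polyakov_toronLink (ω : Fin (d + 1) → ℂ) (x : Tor K) (μ : Fin (d + 1)) : polyakov K (toronLink K ω) x μ = toronHol K ω μ := by
  simp [polyakov, toronHol, Finset.prod_const, Finset.card_univ, Fintype.card_fin]

omit hK in
/-- `K_μ` unit steps in direction `μ` close the cycle: `K_μ • e_μ = 0` on `Π_νℤ∕K_ν`. [folklore] -/
theorem period_nsmul_unitVec (μ : Fin (d + 1)) : (K μ) • unitVec K μ = (0 : Tor K) := by
  funext ν
  rw [Pi.smul_apply, Pi.zero_apply, unitVec]
  by_cases h : ν = μ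
  · subst h; rw [Pi.single_eq_same, nsmul_eq_mul, mul_one, ZMod.natCast_self]
  · rw [Pi.single_eq_of_ne h, smul_zero]

/-- A cyclic shift of a product over `Fin n`: if `f n = f 0` then `Π_{t<n} f(t+1) = Π_{t<n} f(t)`. [folklore] -/
theorem prod_fin_shift {n : ℕ} [NeZero n] (f : ℕ → ℂ) (hf : f n = f 0) : ∏ t : Fin n, f ((t : ℕ) + 1) = ∏ t : Fin n, f t := by
  obtain ⟨k, rfl⟩ : ∃ k, n = k + 1 := Nat.exists_eq_succ_of_ne_zero (NeZero.ne n)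
  rw [Fin.prod_univ_castSucc, Fin.prod_univ_succ (f := fun t : Fin (k + 1) => f t)]
  simp only [Fin.val_castSucc, Fin.val_last, Fin.val_zero, Fin.val_succ]
  rw [hf, mul_comm]

/-- ★★★ **THE POLYAKOV LOOP IS GAUGE INVARIANT**: for every unitary `g : T → U(1)` and every `U(1)` link field, `Π_t U^g(x+te_μ, μ) = Π_t U(x+te_μ, μ)` — the gauge factors telescope
around the CLOSED cycle. [cite: Balaban1985BackgroundPropagators, p.398 l.19; tHooft1979Flux, NPB 153] -/
theorem polyakov_kingGaugeAct {g : Tor K → Matrix Unit Unit ℂ} (hg : ∀ x, g x ∈ Matrix.unitaryGroup Unit ℂ) (U : Tor K × Fin (d + 1) → Matrix Unit Unit ℂ)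
    (x : Tor K) (μ : Fin (d + 1)) : polyakov K (kingGaugeAct K g U) x μ = polyakov K U x μ := by
  unfold polyakov kingGaugeAct
  simp only [unit_mul_apply, Matrix.conjTranspose_apply, Complex.star_def]
  rw [Finset.prod_mul_distrib, Finset.prod_mul_distrib]
  -- the backward gauge factors, shifted once around the closed cycle, are the conjugates of the forward ones
  have hshift : ∏ t : Fin (K μ), conj (g (x + (t : ℕ) • unitVec K μ + unitVec K μ) () ()) = ∏ t : Fin (K μ), conj (g (x + (t : ℕ) • unitVec K μ) () ()) := by
    have h := prod_fin_shift (n := K μ) (fun t => conj (g (x + t • unitVec K μ) () ())) (by simp only [period_nsmul_unitVec, zero_smul])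
    rw [← h]
    refine Finset.prod_congr rfl fun t _ => ?_
    simp only [add_assoc, ← succ_nsmul]
  rw [hshift]
  have hunit : ∀ t : Fin (K μ), g (x + (t : ℕ) • unitVec K μ) () () * conj (g (x + (t : ℕ) • unitVec K μ) () ()) = 1 := fun t => by
    have h1 := (mem_unitaryGroup_unit_iff (g (x + (t : ℕ) • unitVec K μ))).mp (hg _)
    rw [Complex.mul_conj', h1]; norm_num
  calc (∏ t : Fin (K μ), g (x + (t : ℕ) • unitVec K μ) () ()) * (∏ t : Fin (K μ), U (x + (t : ℕ) • unitVec K μ, μ) () ())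
        * ∏ t : Fin (K μ), conj (g (x + (t : ℕ) • unitVec K μ) () ())
      = (∏ t : Fin (K μ), (g (x + (t : ℕ) • unitVec K μ) () () * conj (g (x + (t : ℕ) • unitVec K μ) () ()))) * ∏ t : Fin (K μ), U (x + (t : ℕ) • unitVec K μ, μ) () () := by
          rw [Finset.prod_mul_distrib]; ring
    _ = ∏ t : Fin (K μ), U (x + (t : ℕ) • unitVec K μ, μ) () () := by rw [Finset.prod_congr rfl fun t _ => hunit t, Finset.prod_const_one, one_mul]

/-- ★★ **GAUGE-EQUIVALENT TORONS HAVE THE SAME HOLONOMIES** (the holonomy is not a gauge artefact). [cite: Balaban1985BackgroundPropagators, p.398 l.19; tHooft1979Flux, NPB 153 (twisted boundary conditions)] -/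
theorem toronHol_eq_of_gaugeEquiv {ω ω' : Fin (d + 1) → ℂ} {g : Tor K → Matrix Unit Unit ℂ} (hg : ∀ x, g x ∈ Matrix.unitaryGroup Unit ℂ)
    (h : toronLink K ω' = kingGaugeAct K g (toronLink K ω)) (μ : Fin (d + 1)) : toronHol K ω' μ = toronHol K ω μ := by
  rw [← polyakov_toronLink K ω' 0 μ, ← polyakov_toronLink K ω 0 μ, h, polyakov_kingGaugeAct K hg]

end Holonomy

/-! ## §3 The converse: equal holonomies ⇒ gauge equivalent; reduced representatives -/

section Classification

variable [hK : ∀ μ, NeZero (K μ)]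

/-- A `K`-th root of unity in `ℂ` is a one-step character value: `z^{K_μ} = 1 ⇒ ∃ j : ℤ∕K_μ, z = stdAddChar(j) = e^{2πij∕K_μ}`. [folklore] -/
theorem exists_stdAddChar_eq_of_pow_eq_one (μ : Fin (d + 1)) {z : ℂ} (hz : z ^ K μ = 1) : ∃ j : ZMod (K μ), (ZMod.stdAddChar (N := K μ)) j = z := by
  have hprim := Complex.isPrimitiveRoot_exp (K μ) (NeZero.ne _)
  obtain ⟨i, -, hi⟩ := hprim.eq_pow_of_pow_eq_one hz
  refine ⟨((i : ℤ) : ZMod (K μ)), ?_⟩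
  rw [ZMod.stdAddChar_coe, ← hi, ← Complex.exp_nat_mul]
  congr 1
  push_cast
  field_simp

/-- ★★ **EQUAL HOLONOMIES ⇒ A CHARACTER GAUGE RELATES THE TORONS** (unit phases): `ω_μ^{K_μ} = ω'_μ^{K_μ} ∀μ ⇒ ∃ p, ω' = g_p·ω·g_p^*`. [cite: tHooft1979Flux, NPB 153 (twisted boundary conditions)] -/
theorem exists_charGauge_of_toronHol_eq {ω ω' : Fin (d + 1) → ℂ} (hω : ∀ μ, ‖ω μ‖ = 1) (hω' : ∀ μ, ‖ω' μ‖ = 1) (h : ∀ μ, toronHol K ω' μ = toronHol K ω μ) :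
    ∃ p : Tor K, toronLink K ω' = kingGaugeAct K (charGauge K p) (toronLink K ω) := by
  -- `z_μ := ω_μ · conj ω'_μ` is a `K_μ`-th root of unity
  have hz : ∀ μ, (ω μ * conj (ω' μ)) ^ K μ = 1 := fun μ => by
    rw [mul_pow, ← map_pow]
    have hh : ω μ ^ K μ = ω' μ ^ K μ := (h μ).symm
    rw [hh, Complex.mul_conj', norm_pow, hω']; simp
  choose j hj using fun μ => exists_stdAddChar_eq_of_pow_eq_one K μ (hz μ)
  refine ⟨fun μ => j μ, ?_⟩
  rw [kingGaugeAct_charGauge_toronLink]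
  congr 1
  funext μ
  rw [chi_unitVec]
  show ω' μ = ω μ * conj ((ZMod.stdAddChar (N := K μ)) (j μ))
  rw [hj μ, map_mul, Complex.conj_conj, ← mul_assoc, Complex.mul_conj', hω]; simp

/-- ★★★ **TWO TORONS ARE GAUGE EQUIVALENT IFF THEIR HOLONOMIES AGREE** (unit phases): the gauge classes of constant abelian link fields on `Π_μℤ∕K_μ` are the points
`(ω_μ^{K_μ})_μ ∈ U(1)^{d+1}`. [cite: Balaban1985BackgroundPropagators, p.398 l.19; tHooft1979Flux, NPB 153 (twisted boundary conditions)] -/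
theorem toronLink_gaugeEquiv_iff {ω ω' : Fin (d + 1) → ℂ} (hω : ∀ μ, ‖ω μ‖ = 1) (hω' : ∀ μ, ‖ω' μ‖ = 1) :
    (∃ g : Tor K → Matrix Unit Unit ℂ, (∀ x, g x ∈ Matrix.unitaryGroup Unit ℂ) ∧ toronLink K ω' = kingGaugeAct K g (toronLink K ω))
      ↔ ∀ μ, toronHol K ω' μ = toronHol K ω μ := by
  constructor
  · rintro ⟨g, hg, h⟩ μ
    exact toronHol_eq_of_gaugeEquiv K hg h μ
  · intro h
    obtain ⟨p, hp⟩ := exists_charGauge_of_toronHol_eq K hω hω' h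
    exact ⟨charGauge K p, charGauge_mem_unitaryGroup K p, hp⟩

/-- The holonomy of the reduced toron `e^{iθ∕K}` is `e^{iθ}`. [folklore] -/
theorem toronHol_twistOf_redPhase (θ : Fin (d + 1) → ℝ) (μ : Fin (d + 1)) :
    toronHol K (twistOf fun ν => θ ν / K ν) μ = Complex.exp (((θ μ : ℝ) : ℂ) * I) := by
  rw [toronHol, twistOf, ← Complex.exp_nat_mul]
  congr 1
  have hK : ((K μ : ℕ) : ℂ) ≠ 0 := by exact_mod_cast NeZero.ne (K μ)
  push_cast
  field_simp

/-- ★★ **EVERY TORON IS GAUGE EQUIVALENT TO A REDUCED ONE**: for unit phases `ω` there are angles `θ_μ ∈ [−π, π]` (namely `θ_μ = arg(ω_μ^{K_μ})`) and a unitary gauge `g` with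
`e^{iθ∕K} = g·ω·g^*` — the hypothesis «reduced angles» of PART Ͷ-d is no loss of generality. [cite: tHooft1979Flux, NPB 153 (twisted boundary conditions)] -/
theorem exists_reduced_gaugeEquiv {ω : Fin (d + 1) → ℂ} (hω : ∀ μ, ‖ω μ‖ = 1) :
    ∃ θ : Fin (d + 1) → ℝ, (∀ μ, |θ μ| ≤ Real.pi) ∧
      ∃ g : Tor K → Matrix Unit Unit ℂ, (∀ x, g x ∈ Matrix.unitaryGroup Unit ℂ) ∧ toronLink K (twistOf fun ν => θ ν / K ν) = kingGaugeAct K g (toronLink K ω) := by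
  refine ⟨fun μ => Complex.arg (ω μ ^ K μ), fun μ => Complex.abs_arg_le_pi _, ?_⟩
  refine (toronLink_gaugeEquiv_iff K hω (fun μ => norm_twistOf_eq_one _ μ)).mpr fun μ => ?_
  rw [toronHol_twistOf_redPhase, toronHol]
  have h1 : ‖ω μ ^ K μ‖ = 1 := by rw [norm_pow, hω, one_pow]
  have := Complex.norm_mul_exp_arg_mul_I (ω μ ^ K μ)
  rw [h1, Complex.ofReal_one, one_mul] at this
  exact this

end Classification

/-! ## §4 The spectrum depends on the phases only through the holonomy -/

section Spectrum

variable [hK : ∀ μ, NeZero (K μ)]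

/-- The reduced momentum of a sum, modulo `2π`: `cos(p′_μ(q+p) + a) = cos(p′_μ(q) + p′_μ(p) + a)` (characters multiply). [folklore] -/
theorem cos_sOf_add (q p : Tor K) (μ : Fin (d + 1)) (a : ℝ) : Real.cos (sOf K (q + p) μ + a) = Real.cos (sOf K q μ + sOf K p μ + a) := by
  have h : Complex.exp (((sOf K (q + p) μ : ℝ) : ℂ) * I) = Complex.exp (((sOf K q μ + sOf K p μ : ℝ) : ℂ) * I) := by
    rw [← chi_unitVec_eq_exp, chi_add_left]
    rw [chi_unitVec_eq_exp, chi_unitVec_eq_exp, ← Complex.exp_add]; congr 1; push_cast; ring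
  have h2 : Complex.exp (((sOf K (q + p) μ + a : ℝ) : ℂ) * I) = Complex.exp (((sOf K q μ + sOf K p μ + a : ℝ) : ℂ) * I) := by
    rw [show (((sOf K (q + p) μ + a : ℝ) : ℂ) * I) = ((sOf K (q + p) μ : ℝ) : ℂ) * I + ((a : ℝ) : ℂ) * I by push_cast; ring, Complex.exp_add, h, ← Complex.exp_add]
    congr 1; push_cast; ring
  have := congrArg Complex.re h2
  rwa [Complex.exp_ofReal_mul_I_re, Complex.exp_ofReal_mul_I_re] at this

/-- `lapSymTw(φ − p′(p), q + p) = lapSymTw(φ, q)`: a dual-lattice shift of the phases relabels the momentum grid. [cite: King1986, (4.4) p.670; Balaban1984PropagatorsI, (1.29) p.23] -/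
theorem lapSymTw_sub_sOf (c m2 : ℝ) (φ : Fin (d + 1) → ℝ) (p q : Tor K) : lapSymTw K c m2 (φ - sOf K p) (q + p) = lapSymTw K c m2 φ q := by
  unfold lapSymTw
  congr 1; congr 1
  refine Finset.sum_congr rfl fun μ _ => ?_
  rw [Pi.sub_apply, cos_sOf_add]
  congr 2; ring_nf

/-- ★★ **THE SPECTRUM IS A FUNCTION OF THE HOLONOMY**: for every `F`, `Σ_q F(lapSymTw(φ − p′(p), q)) = Σ_q F(lapSymTw(φ, q))` — the multiset of eigenvalues of the toron operator is
invariant under the dual-lattice shifts of `φ` (i.e. under the character gauges), so every spectral quantity (determinant, trace, diagonal of the covariance, the gap) depends on the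
phases only through `(e^{iK_μφ_μ})_μ`. [cite: King1986, (4.4) p.670; tHooft1979Flux, NPB 153] -/
theorem sum_lapSymTw_sub_sOf {α : Type*} [AddCommMonoid α] (F : ℝ → α) (c m2 : ℝ) (φ : Fin (d + 1) → ℝ) (p : Tor K) :
    ∑ q : Tor K, F (lapSymTw K c m2 (φ - sOf K p) q) = ∑ q : Tor K, F (lapSymTw K c m2 φ q) := by
  rw [← Equiv.sum_comp (Equiv.addRight p)]
  exact Finset.sum_congr rfl fun q _ => by rw [Equiv.coe_addRight, lapSymTw_sub_sOf]

/-- The same for products (the determinant). [cite: King1986, (3.89) p.668] -/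
theorem prod_lapSymTw_sub_sOf {α : Type*} [CommMonoid α] (F : ℝ → α) (c m2 : ℝ) (φ : Fin (d + 1) → ℝ) (p : Tor K) :
    ∏ q : Tor K, F (lapSymTw K c m2 (φ - sOf K p) q) = ∏ q : Tor K, F (lapSymTw K c m2 φ q) := by
  rw [← Equiv.prod_comp (Equiv.addRight p)]
  exact Finset.prod_congr rfl fun q _ => by rw [Equiv.coe_addRight, lapSymTw_sub_sOf]

/-- ★ GAUGE COVARIANCE OF THE TORON OPERATOR under a character gauge (PART Ͱ-a `covLapF_kingGaugeAct` by name): `M_{e^{i(φ−p′(p))}} = D_{g_p}·M_{e^{iφ}}·D_{g_p}^*`.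
[cite: Balaban1985BackgroundPropagators, p.398 l.19] -/
theorem covLapF_toronLink_sub_sOf (c m2 : ℝ) (φ : Fin (d + 1) → ℝ) (p : Tor K) :
    covLapF K c m2 (toronLink K (twistOf (φ - sOf K p)))
      = kingGaugeMat K (charGauge K p) * covLapF K c m2 (toronLink K (twistOf φ)) * (kingGaugeMat K (charGauge K p))ᴴ := by
  rw [← kingGaugeAct_charGauge_toronLink_twistOf]
  exact Summit.QuantumFields.YangMills.BalabanUVNodes.N15KingModelRung.Covariant.covLapF_kingGaugeAct K c m2 (charGauge_mem_unitaryGroup K p) _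

end Spectrum

/-! ## §5 The seam gauge: twisted boundary conditions -/

section Seam

variable [hK : ∀ μ, NeZero (K μ)]

/-- THE SEAM GAUGE `g(x) = Π_ν ω_ν^{val x_ν}` (straight-line transport from the origin). [cite: tHooft1979Flux, NPB 153 (twisted boundary conditions)] -/
def seamGauge (ω : Fin (d + 1) → ℂ) : Tor K → Matrix Unit Unit ℂ := fun x => Matrix.of fun _ _ => ∏ ν, ω ν ^ (x ν).val

omit hK in
/-- Entries. [folklore] -/
@[simp] theorem seamGauge_apply (ω : Fin (d + 1) → ℂ) (x : Tor K) (i j : Unit) : seamGauge K ω x i j = ∏ ν, ω ν ^ (x ν).val := rfl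

omit hK in
/-- The seam gauge is unitary for unit phases. [folklore] -/
theorem seamGauge_mem_unitaryGroup {ω : Fin (d + 1) → ℂ} (hω : ∀ μ, ‖ω μ‖ = 1) (x : Tor K) : seamGauge K ω x ∈ Matrix.unitaryGroup Unit ℂ :=
  (mem_unitaryGroup_unit_iff (seamGauge K ω x)).mpr (by
    rw [seamGauge_apply, norm_prod, Finset.prod_eq_one fun ν _ => by rw [norm_pow, hω, one_pow]])

omit hK in
/-- The coordinates of `x + e_μ` in `ℕ`: `val x_ν` off `μ`, `val(x_μ + 1)` at `μ`. [folklore] -/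
theorem val_add_unitVec_apply (x : Tor K) (μ ν : Fin (d + 1)) : ((x + unitVec K μ) ν).val = if ν = μ then ((x μ + 1 : ZMod (K μ))).val else (x ν).val := by
  by_cases h : ν = μ
  · subst h; rw [if_pos rfl, Pi.add_apply, unitVec, Pi.single_eq_same]
  · rw [if_neg h, Pi.add_apply, unitVec, Pi.single_eq_of_ne h, add_zero]

/-- `val(x_μ + 1)`: `val x_μ + 1` off the seam, `0` on the seam `val x_μ + 1 = K_μ`. [folklore] -/
theorem val_add_one_eq (μ : Fin (d + 1)) (a : ZMod (K μ)) : (a + 1).val = if a.val + 1 < K μ then a.val + 1 else 0 := by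
  have hK0 : 0 < K μ := Nat.pos_of_ne_zero (NeZero.ne _)
  rcases Nat.lt_or_ge 1 (K μ) with h1 | h1
  · haveI : Fact (1 < K μ) := ⟨h1⟩
    rw [ZMod.val_add, ZMod.val_one]
    split_ifs with h
    · exact Nat.mod_eq_of_lt h
    · have : a.val + 1 = K μ := by have := ZMod.val_lt a; omega
      rw [this, Nat.mod_self]
  · have hK1 : K μ = 1 := le_antisymm h1 hK0
    have hval : ∀ b : ZMod (K μ), b.val = 0 := fun b => by have := ZMod.val_lt b; omega
    rw [hval, hval, hK1]; simp

/-- ★★ **THE SEAM GAUGE OF A TORON IS 't HOOFT's TWISTED BOUNDARY CONDITION**: for unit phases, `(g·ω·g^*)(x,μ) = 1` off the seam (`val x_μ + 1 < K_μ`) and `= ω_μ^{K_μ}` (the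
holonomy) on the seam — the constant-link presentation and the twisted-boundary-condition presentation are the same gauge class. [cite: Balaban1985BackgroundPropagators, p.398 l.19; tHooft1979Flux, NPB 153 (twisted boundary conditions)] -/
theorem kingGaugeAct_seamGauge_toronLink {ω : Fin (d + 1) → ℂ} (hω : ∀ μ, ‖ω μ‖ = 1) (x : Tor K) (μ : Fin (d + 1)) :
    kingGaugeAct K (seamGauge K ω) (toronLink K ω) (x, μ) () () = if (x μ).val + 1 < K μ then 1 else toronHol K ω μ := by
  have hne : ∀ ν, ω ν ≠ 0 := fun ν h => by have := hω ν; rw [h, norm_zero] at this; exact zero_ne_one this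
  have hinv : ∀ ν, conj (ω ν) = (ω ν)⁻¹ := fun ν =>
    eq_inv_of_mul_eq_one_left (by rw [Complex.conj_mul', hω]; simp)
  change (seamGauge K ω x * toronLink K ω (x, μ) * (seamGauge K ω (x + unitVec K μ))ᴴ) () () = _
  rw [unit_mul_apply, unit_mul_apply, Matrix.conjTranspose_apply, seamGauge_apply, seamGauge_apply, toronLink_apply, Complex.star_def, map_prod]
  simp_rw [map_pow, hinv, val_add_unitVec_apply]
  -- split the products over `ν` into the factor `ν = μ` and the rest
  rw [← Finset.mul_prod_erase Finset.univ (fun ν => ω ν ^ (x ν).val) (Finset.mem_univ μ),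
    ← Finset.mul_prod_erase Finset.univ (fun ν => (ω ν)⁻¹ ^ (if ν = μ then ((x μ + 1 : ZMod (K μ))).val else (x ν).val)) (Finset.mem_univ μ)]
  simp only [if_true]
  have hoff : ∏ ν ∈ Finset.univ.erase μ, (ω ν)⁻¹ ^ (if ν = μ then ((x μ + 1 : ZMod (K μ))).val else (x ν).val) = ∏ ν ∈ Finset.univ.erase μ, (ω ν)⁻¹ ^ (x ν).val := by
    refine Finset.prod_congr rfl fun ν hν => ?_
    rw [if_neg (Finset.ne_of_mem_erase hν)]
  rw [hoff, val_add_one_eq]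
  have hcancel : (∏ ν ∈ Finset.univ.erase μ, ω ν ^ (x ν).val) * ∏ ν ∈ Finset.univ.erase μ, (ω ν)⁻¹ ^ (x ν).val = 1 := by
    rw [← Finset.prod_mul_distrib, Finset.prod_eq_one fun ν _ => by rw [inv_pow, mul_inv_cancel₀ (pow_ne_zero _ (hne ν))]]
  split_ifs with h
  · calc ω μ ^ (x μ).val * (∏ ν ∈ Finset.univ.erase μ, ω ν ^ (x ν).val) * ω μ * ((ω μ)⁻¹ ^ ((x μ).val + 1) * ∏ ν ∈ Finset.univ.erase μ, (ω ν)⁻¹ ^ (x ν).val)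
        = (ω μ ^ ((x μ).val + 1) * (ω μ)⁻¹ ^ ((x μ).val + 1)) * ((∏ ν ∈ Finset.univ.erase μ, ω ν ^ (x ν).val) * ∏ ν ∈ Finset.univ.erase μ, (ω ν)⁻¹ ^ (x ν).val) := by ring
      _ = 1 := by rw [hcancel, inv_pow, mul_inv_cancel₀ (pow_ne_zero _ (hne μ)), one_mul]
  · have hK : (x μ).val + 1 = K μ := by have := ZMod.val_lt (x μ); omega
    calc ω μ ^ (x μ).val * (∏ ν ∈ Finset.univ.erase μ, ω ν ^ (x ν).val) * ω μ * ((ω μ)⁻¹ ^ 0 * ∏ ν ∈ Finset.univ.erase μ, (ω ν)⁻¹ ^ (x ν).val)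
        = ω μ ^ ((x μ).val + 1) * ((∏ ν ∈ Finset.univ.erase μ, ω ν ^ (x ν).val) * ∏ ν ∈ Finset.univ.erase μ, (ω ν)⁻¹ ^ (x ν).val) := by ring
      _ = toronHol K ω μ := by rw [hcancel, mul_one, hK, toronHol]

end Seam

end Summit.QuantumFields.YangMills.BalabanUVNodes.N15KingModelRung.Toron

end
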